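import Mathlib
import HarnessLib

/-!
# Route `VirialFluxGap` (YangMills): LAPLACE LAYER CAKE — `∫e^{−βF}dμ` and `∫F e^{−βF}dμ` as integrals of the small-ball volume function

First step shared by BOTH Tauberian stubs of planner ym-idea-4 g14's second lines on route `VirialFluxGap` — `stub_tauberUniform`
(LINE «tauber», crux `SharpTwistedLaplace` stmt-QuantumFields-24204; owner/LEAD material) and `stub_tauberMeanUpper` (LINE «tauber-mean»,
deciding crux `PeriodicSoftness` stmt-QuantumFields-24141): for a finite measure `μ`, a measurable `F ≥ 0` and `β > 0`, with the
CLOSED-RAY volume function `m(s) = μ{F ≤ s}` (exactly the function the volume laws `VolumeExponent` / `PeriodicVolumeLaw` speak about),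

* `∫ e^{−βF} dμ = ∫_{s>0} β e^{−βs} · m(s) ds`            (`integral_exp_neg_mul_eq_integral_cdf`),
* `∫ F e^{−βF} dμ = ∫_{s>0} (βs − 1) e^{−βs} · m(s) ds`     (`integral_mul_exp_neg_mul_eq_integral_cdf`),

hence `β⟨F⟩_β = ∫(β²s − β)e^{−βs} m(s) ds / ∫ βe^{−βs} m(s) ds` (the ratio form quoted in the «tauber-mean» card).  Mechanism: the
generic `integral_setIntegral_Ioi_eq_integral_mul_cdf` — for `g` integrable on `(0,∞)`, `∫ (∫_{s > F ω} g) dμ(ω) = ∫_{s>0} g(s)·μ{F ≤ s} ds`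
(Fubini for the indicator of the measurable set `{(ω,s) : F ω ≤ s}` against `μ ⊗ Lebesgue|_(0,∞)`; the closed ray appears because
`(0,∞) ∩ [F ω, ∞)` and `(F ω, ∞)` differ by one point) — applied to the two tails `∫_{s>t} βe^{−βs}ds = e^{−βt}` and
`∫_{s>t} (βs−1)e^{−βs}ds = t e^{−βt}` (FTC on `[t,∞)`).

HONEST FRAMING: generic real analysis (Mathlib only); no stub / crux / rung / summit is closed by this file; the Yang–Mills mass gap is NOT proved.
THEOREMS ONLY (0 `def`, 0 `sorry`), standard axioms.  References: [cite: Griffiths1964]; [cite: TomboulisYaffe1985].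
-/

set_option autoImplicit false

noncomputable section

open MeasureTheory Set Filter Real
open scoped Topology

namespace Summit.QuantumFields.YangMills.Theorems.VirialFluxGap.LaplaceLayerCake

/-! ## §1 Two exponential tails -/

/-- `∫_{s>t} β e^{−βs} ds = e^{−βt}`. [folklore] -/
theorem integral_Ioi_const_mul_exp_neg_mul {β : ℝ} (hβ : 0 < β) (t : ℝ) :
    ∫ s in Ioi t, β * Real.exp (-(β * s)) = Real.exp (-(β * t)) := by
  have h := integral_exp_mul_Ioi (a := -β) (by linarith) t
  simp_rw [neg_mul] at h
  rw [integral_const_mul, h]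
  field_simp

/-- `∫_{s>t} (βs − 1) e^{−βs} ds = t e^{−βt}` for `t ≥ 0`. [folklore] -/
theorem integral_Ioi_sub_one_mul_exp_neg_mul {β : ℝ} (hβ : 0 < β) {t : ℝ} (ht : 0 ≤ t) :
    ∫ s in Ioi t, (β * s - 1) * Real.exp (-(β * s)) = t * Real.exp (-(β * t)) := by
  -- antiderivative `f(s) = −s e^{−βs}`, `f' = (βs−1)e^{−βs}`, `f → 0`
  have hderiv : ∀ s ∈ Ioi t, HasDerivAt (fun s : ℝ => -(s * Real.exp (-(β * s)))) ((β * s - 1) * Real.exp (-(β * s))) s := by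
    intro s _
    have h1 : HasDerivAt (fun s : ℝ => -(β * s)) (-β) s := by
      have := (hasDerivAt_id s).const_mul (-β)
      simpa [neg_mul] using this
    have h2 : HasDerivAt (fun s : ℝ => Real.exp (-(β * s))) (Real.exp (-(β * s)) * (-β)) s := h1.exp
    have h3 : HasDerivAt (fun y : ℝ => y * Real.exp (-(β * y))) (1 * Real.exp (-(β * s)) + s * (Real.exp (-(β * s)) * (-β))) s :=
      (hasDerivAt_id' s).mul h2
    refine h3.neg.congr_deriv ?_
    ring
  have hcont : ContinuousWithinAt (fun s : ℝ => -(s * Real.exp (-(β * s)))) (Ici t) t :=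
    ((continuous_id.mul (continuous_exp.comp (continuous_const.mul continuous_id).neg)).neg).continuousWithinAt
  -- integrability of `f'` on `(t, ∞)` from the Gamma-type integrability on `(0, ∞)`
  have hint0 : IntegrableOn (fun s : ℝ => (β * s - 1) * Real.exp (-(β * s))) (Ioi 0) := by
    have h1 : IntegrableOn (fun s : ℝ => s ^ (1 : ℝ) * Real.exp (-β * s ^ (1 : ℝ))) (Ioi 0) :=
      integrableOn_rpow_mul_exp_neg_mul_rpow (by norm_num) le_rfl hβ
    have h0 : IntegrableOn (fun s : ℝ => s ^ (0 : ℝ) * Real.exp (-β * s ^ (1 : ℝ))) (Ioi 0) :=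
      integrableOn_rpow_mul_exp_neg_mul_rpow (by norm_num) le_rfl hβ
    have h1' : IntegrableOn (fun s : ℝ => s * Real.exp (-(β * s))) (Ioi 0) :=
      h1.congr_fun (fun s _ => by simp only [Real.rpow_one, neg_mul]) measurableSet_Ioi
    have h0' : IntegrableOn (fun s : ℝ => Real.exp (-(β * s))) (Ioi 0) :=
      h0.congr_fun (fun s _ => by simp only [Real.rpow_zero, Real.rpow_one, one_mul, neg_mul]) measurableSet_Ioi
    have h : IntegrableOn (fun s : ℝ => β * (s * Real.exp (-(β * s))) - Real.exp (-(β * s))) (Ioi 0) :=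
      (h1'.const_mul β).sub h0'
    refine h.congr_fun (fun s _ => ?_) measurableSet_Ioi
    ring
  have hint : IntegrableOn (fun s : ℝ => (β * s - 1) * Real.exp (-(β * s))) (Ioi t) :=
    hint0.mono_set (Ioi_subset_Ioi ht)
  have hlim : Tendsto (fun s : ℝ => -(s * Real.exp (-(β * s)))) atTop (𝓝 0) := by
    have h := (tendsto_rpow_mul_exp_neg_mul_atTop_nhds_zero 1 β hβ).neg
    rw [neg_zero] at h
    refine h.congr' ?_
    filter_upwards [eventually_ge_atTop (0 : ℝ)] with s _
    simp only [Real.rpow_one, neg_mul]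
  rw [integral_Ioi_of_hasDerivAt_of_tendsto hcont hderiv hint hlim]
  ring

/-! ## §2 The generic layer cake in the closed-ray volume function -/

variable {Ω : Type*} [MeasurableSpace Ω] (μ : Measure Ω) [IsFiniteMeasure μ] {F : Ω → ℝ}

/-- For `t ≥ 0`: `∫_{s>0} 𝟙[t ≤ s] g(s) ds = ∫_{s>t} g(s) ds` (the sets `(0,∞) ∩ [t,∞)` and `(t,∞)` differ by at most one point). [folklore] -/
theorem setIntegral_Ioi_indicator_Ici {t : ℝ} (ht : 0 ≤ t) (g : ℝ → ℝ) :
    ∫ s in Ioi (0 : ℝ), (Ici t).indicator g s = ∫ s in Ioi t, g s := by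
  rw [setIntegral_indicator measurableSet_Ici]
  refine setIntegral_congr_set ?_
  rcases ht.eq_or_lt with h | h
  · subst h
    rw [inter_eq_left.mpr (Ioi_subset_Ici_self)]
  · rw [inter_eq_right.mpr (Ici_subset_Ioi.mpr h)]
    exact Ioi_ae_eq_Ici.symm

/-- ★ **Generic layer cake in the closed-ray volume function**: for `F ≥ 0` measurable and `g` integrable on `(0,∞)`,
`∫ (∫_{s > F ω} g(s) ds) dμ(ω) = ∫_{s>0} g(s) · μ{F ≤ s} ds`. [folklore] -/
theorem integral_setIntegral_Ioi_eq_integral_mul_cdf (hF : Measurable F) (hF0 : ∀ ω, 0 ≤ F ω)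
    {g : ℝ → ℝ} (hg : IntegrableOn g (Ioi 0)) :
    ∫ ω, (∫ s in Ioi (F ω), g s) ∂μ = ∫ s in Ioi (0 : ℝ), g s * μ.real {ω | F ω ≤ s} := by
  -- the integrand of the double integral
  set G : Ω → ℝ → ℝ := fun ω s => (Ici (F ω)).indicator g s with hG
  have hGS : ∀ ω s, G ω s = ({p : Ω × ℝ | F p.1 ≤ p.2}).indicator (fun p => g p.2) (ω, s) := by
    intro ω s
    simp only [hG, Set.indicator_apply, mem_Ici, mem_setOf_eq]
  have hS : MeasurableSet {p : Ω × ℝ | F p.1 ≤ p.2} := measurableSet_le (hF.comp measurable_fst) measurable_snd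
  -- integrability on the product `μ ⊗ Lebesgue|_(0,∞)`
  have hint : Integrable (Function.uncurry G) (μ.prod (volume.restrict (Ioi (0 : ℝ)))) := by
    have hb : Integrable (fun p : Ω × ℝ => g p.2) (μ.prod (volume.restrict (Ioi (0 : ℝ)))) := hg.comp_snd μ
    have hG' : Function.uncurry G = ({p : Ω × ℝ | F p.1 ≤ p.2}).indicator (fun p => g p.2) := by
      funext p; exact hGS p.1 p.2
    rw [hG']
    exact hb.indicator hS
  -- inner integrals
  have hinner : ∀ ω, ∫ s in Ioi (0 : ℝ), G ω s = ∫ s in Ioi (F ω), g s := fun ω =>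
    setIntegral_Ioi_indicator_Ici (hF0 ω) g
  have houter : ∀ s, ∫ ω, G ω s ∂μ = g s * μ.real {ω | F ω ≤ s} := by
    intro s
    have h1 : (fun ω => G ω s) = ({ω | F ω ≤ s}).indicator (fun _ => g s) := by
      funext ω
      simp only [hG, Set.indicator_apply, mem_Ici, mem_setOf_eq]
    rw [h1, integral_indicator_const (g s) (measurableSet_le hF measurable_const), smul_eq_mul, mul_comm]
  calc ∫ ω, (∫ s in Ioi (F ω), g s) ∂μ = ∫ ω, (∫ s in Ioi (0 : ℝ), G ω s) ∂μ := by
        refine integral_congr_ae (ae_of_all _ fun ω => (hinner ω).symm)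
    _ = ∫ s in Ioi (0 : ℝ), (∫ ω, G ω s ∂μ) := integral_integral_swap hint
    _ = ∫ s in Ioi (0 : ℝ), g s * μ.real {ω | F ω ≤ s} := by
        refine integral_congr_ae (ae_of_all _ fun s => houter s)

/-! ## §3 The two Laplace layer cakes -/

/-- ★★ **`∫ e^{−βF} dμ = ∫_{s>0} β e^{−βs} · μ{F ≤ s} ds`** (`F ≥ 0` measurable, `β > 0`, `μ` finite). [cite: Griffiths1964] -/
theorem integral_exp_neg_mul_eq_integral_cdf (hF : Measurable F) (hF0 : ∀ ω, 0 ≤ F ω) {β : ℝ} (hβ : 0 < β) :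
    ∫ ω, Real.exp (-(β * F ω)) ∂μ = ∫ s in Ioi (0 : ℝ), β * Real.exp (-(β * s)) * μ.real {ω | F ω ≤ s} := by
  have hg : IntegrableOn (fun s : ℝ => β * Real.exp (-(β * s))) (Ioi 0) := by
    have h : IntegrableOn (fun s : ℝ => β * Real.exp (-β * s)) (Ioi 0) := (exp_neg_integrableOn_Ioi 0 hβ).const_mul β
    refine h.congr_fun (fun s _ => ?_) measurableSet_Ioi
    simp only [neg_mul]
  rw [← integral_setIntegral_Ioi_eq_integral_mul_cdf μ hF hF0 hg]
  refine integral_congr_ae (ae_of_all _ fun ω => ?_)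
  exact (integral_Ioi_const_mul_exp_neg_mul hβ (F ω)).symm

/-- ★★ **`∫ F e^{−βF} dμ = ∫_{s>0} (βs − 1) e^{−βs} · μ{F ≤ s} ds`** (`F ≥ 0` measurable, `β > 0`, `μ` finite). [cite: Griffiths1964] -/
theorem integral_mul_exp_neg_mul_eq_integral_cdf (hF : Measurable F) (hF0 : ∀ ω, 0 ≤ F ω) {β : ℝ} (hβ : 0 < β) :
    ∫ ω, F ω * Real.exp (-(β * F ω)) ∂μ = ∫ s in Ioi (0 : ℝ), (β * s - 1) * Real.exp (-(β * s)) * μ.real {ω | F ω ≤ s} := by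
  have hg : IntegrableOn (fun s : ℝ => (β * s - 1) * Real.exp (-(β * s))) (Ioi 0) := by
    have h1 : IntegrableOn (fun s : ℝ => s ^ (1 : ℝ) * Real.exp (-β * s ^ (1 : ℝ))) (Ioi 0) :=
      integrableOn_rpow_mul_exp_neg_mul_rpow (by norm_num) le_rfl hβ
    have h0 : IntegrableOn (fun s : ℝ => s ^ (0 : ℝ) * Real.exp (-β * s ^ (1 : ℝ))) (Ioi 0) :=
      integrableOn_rpow_mul_exp_neg_mul_rpow (by norm_num) le_rfl hβ
    have h1' : IntegrableOn (fun s : ℝ => s * Real.exp (-(β * s))) (Ioi 0) :=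
      h1.congr_fun (fun s _ => by simp only [Real.rpow_one, neg_mul]) measurableSet_Ioi
    have h0' : IntegrableOn (fun s : ℝ => Real.exp (-(β * s))) (Ioi 0) :=
      h0.congr_fun (fun s _ => by simp only [Real.rpow_zero, Real.rpow_one, one_mul, neg_mul]) measurableSet_Ioi
    have h : IntegrableOn (fun s : ℝ => β * (s * Real.exp (-(β * s))) - Real.exp (-(β * s))) (Ioi 0) :=
      (h1'.const_mul β).sub h0'
    refine h.congr_fun (fun s _ => ?_) measurableSet_Ioi
    ring
  rw [← integral_setIntegral_Ioi_eq_integral_mul_cdf μ hF hF0 hg]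
  refine integral_congr_ae (ae_of_all _ fun ω => ?_)
  exact (integral_Ioi_sub_one_mul_exp_neg_mul hβ (hF0 ω)).symm

end Summit.QuantumFields.YangMills.Theorems.VirialFluxGap.LaplaceLayerCake

end
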